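import Mathlib
import Summits.HodgeConjecture.FermatCycles.HodgeFermatCoincFullB
import Summits.HodgeConjecture.FermatCycles.HodgeFermatPropDPrimeNA

/-!
# THE DESCENT AT THE LEVELS 15N AND 21N from (JP₁₅)/(JP₂₁) — THEOREM F15⁺/F21⁺ of DPRIME §13 reduced to its jointly primitive core — the STATEMENT (count-neutral)

Cell `pub-hfermat` (tree path `Summits/HodgeConjecture/FermatCycles/`), seat prover-1 gen-4, acting on the
COORDINATOR KEEPER RULING of 2026-08-25 (gem sweep H1: take the off-gate kernel theorem `thmFstar` through the
normal gate, statement first).  After THEOREM F* at the prime levels (`HodgeFermatThmFstar.lean`, HF-G32), F*(3N)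
(`HodgeFermatThmFstarN.lean`, HF-G33) and PROPOSITION D′(3N) with THE DESCENT at the levels `3N`
(`HodgeFermatPropDPrimeNFinal.lean`, HF-G34), the last off-gate member of the family in the sibling package
`run/shared/lean/pub/pub-hodgefermat/lean/HodgeFermat/` is THE DESCENT AT THE LEVELS `15N` AND `21N`
(`HodgeFermat/DescentB.lean`, 453 lines, sha256 `bcd014a39d36…`; `HodgeFermat/DescentBFinal.lean`, 85 lines, sha256
`596ae4ebb7e1…`, lake-only there; pub-hodgefermat `CERT.md` l.993 / `GATE.md` l.2063, GATE HF-G34b, verdict GREEN; hub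
records the split pair `check/DescentB_link_standalone.lean` sha256 `616bf184267f3ed3…` rc 0 — `--axioms …descent15` /
`…descent21` = [propext, Classical.choice, Quot.sound] + exactly the admitted one-line kernel certificate
`CoincFull.fullCheck_39`, itself PROVED (`decide +kernel`, axioms []) in `check/DecodingDPrime_part1_standalone.lean`
sha256 `e147557e91070793…` rc 0 and landed here in `HodgeFermatCoincFullK.lean`) — never put through the gate.
This file files its STATEMENTS first, as `Prop`-valued definitions and nothing else: the hypothesis `(JP_m₀)` and the
two lists `big15`, `big21` VERBATIM from `DescentB.lean` (l.55–76; declared HERE, in their own namespace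
`HodgeFermat.KRFree.DescentB`, and not repeated in `HodgeFermatDescentBA.lean`, which imports this file — the precedent
is `LemmaN.InH`/`SameType` in `HodgeFermatThmFstarStatement.lean`), and the two statements `Descent15`, `Descent21` =
the universal closures of the signatures of `DescentBFinal.descent15` / `descent21` (`DescentBFinal.lean:32`, `:59`),
whose ONLY hypothesis is `JP 15` resp. `JP 21`.  The proof follows in `HodgeFermatDescentBA.lean` /
`HodgeFermatDescentBB.lean` (`DescentB.lean` split at its §2|§3 boundary, bodies verbatim) and
`HodgeFermatDescentBFinal.lean` (`DescentBFinal.lean` verbatim + `descent15_holds : Descent15`, `descent21_holds : Descent21`).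

THE STATEMENT (pub-hodgefermat `tables/DPRIME-THEOREM.md` §13.1).  THEOREM F15⁺/F21⁺ (§13): at every squarefree level
`m = m₀·m₁`, `m₀ ∈ {15, 21}`, all primes of `m₁ ≥ 11`, every DISJOINT coincidence of CM types of zero-sum triples has
reduced level in `B = {15, 21, 39}`.  §13.1 reduces this to **(JP_m₀)**: for every squarefree `m₁ > 1` with all primes
`≥ 11` there is no disjoint JOINTLY PRIMITIVE coincidence of level `m₀·m₁` — whose own proof (§13.2–13.5, the
analytic half) is NOT in the kernel, in the sibling or here.  What IS a kernel theorem, and is filed here, is the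
reduction: `Descent15` — GIVEN (JP₁₅), for every squarefree `N > 0` with all prime factors `≥ 11`, two zero-sum
triples mod `15N` with no entry `≡ 0 (mod 15N)`, DISJOINT mod `15N`, of the same CM type at level `15N`, are EITHER
`5g` times a pair of one of the two all-unit classes `PropDPrimeN.units39` mod `39` with `N = 13g` (reduced level
`39`) OR `N` times a pair of one of the two six-element classes `big15` of the complete level-15 list
`CoincFull.classes15` (reduced level `15`); `Descent21` — the same at `21N` with `7` for `5` and `big21 ⊂ classes21`.
The hypothesis is level-sensitive and not vacuous: `JP 3` is false (`DescentB.not_JP_three`, the level-39 unit pair),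
and the converses `big15_lift` / `big21_lift` / `units39_lift15` / `units39_lift21` (hypothesis-free, in the proof
files) show the description is exact.  Context: for the Fermat variety of degree `m` the CM type of `(a, b, c)` is
`H_T ∩ (ℤ/m)ˣ` (Koblitz–Rohrlich 1978); these descents are the combinatorial input of the sibling's analysis of the
Hodge gap groups `G_m` at `m = 15N`, `21N` (this cell's DOOR.md §0 / RESULTS-FERMAT.md; no claim on general Hodge is
made or implied here).

HONEST FRAMING: explicit algebraic cycles for specific Hodge classes on Fermat/Delsarte varieties; residual open
instances listed; no claim on general Hodge.  No `sorry`; `Prop`-valued / list-valued definitions only (count-neutral):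
`JP`, `big15`, `big21` (verbatim), `Descent15`, `Descent21` (new names for the universal closures; CONDITIONAL on
(JP₁₅)/(JP₂₁) by construction — the antecedent is part of each statement).
-/

set_option autoImplicit false

namespace HodgeFermat.KRFree.DescentB

open HodgeFermat.KRFree.LemmaN

/-! ## The hypothesis (JP_m₀) and the two big classes at 15 and 21 (`HodgeFermat/DescentB.lean` l.55–76, verbatim) -/

/-- **(JP_m₀)** of `tables/DPRIME-THEOREM.md` §13.1: for every squarefree `N > 1` with all prime factors `≥ 11` there is no
DISJOINT, JOINTLY PRIMITIVE coincidence of CM types at level `m₀·N` (two zero-sum triples mod `m₀N`, no entry `≡ 0`, no prime of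
`m₀N` dividing all six entries, disjoint mod `m₀N`, same CM type). -/
def JP (m₀ : ℕ) : Prop :=
  ∀ N a b c a' b' c' : ℕ, 1 < N → Squarefree N → (∀ p ∈ N.primeFactors, 11 ≤ p) →
    m₀ * N ∣ a + b + c → ¬ m₀ * N ∣ a → ¬ m₀ * N ∣ b → ¬ m₀ * N ∣ c →
    m₀ * N ∣ a' + b' + c' → ¬ m₀ * N ∣ a' → ¬ m₀ * N ∣ b' → ¬ m₀ * N ∣ c' →
    (∀ q, Nat.Prime q → q ∣ m₀ * N → q ∣ a → q ∣ b → q ∣ c → q ∣ a' → q ∣ b' → q ∣ c' → False) →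
    (∀ u v, (u = a ∨ u = b ∨ u = c) → (v = a' ∨ v = b' ∨ v = c') → ¬ u ≡ v [MOD m₀ * N]) →
    SameType (m₀ * N) (a, b, c) (a', b', c') → False

/-- the two six-element classes of `CoincFull.classes15`: `(1,2,12) ∼ (1,4,10) ∼ (1,6,8) ∼ (2,4,9) ∼ (2,5,8) ∼ (3,4,8)` and its
negative (each carries three disjoint pairs: the six disjoint coincidences of level `15`) -/
def big15 : List (List CoincFull.Tri) :=
  [[(1, 2, 12), (1, 4, 10), (1, 6, 8), (2, 4, 9), (2, 5, 8), (3, 4, 8)],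
   [(3, 13, 14), (5, 11, 14), (6, 11, 13), (7, 9, 14), (7, 10, 13), (7, 11, 12)]]

/-- the two six-element classes of `CoincFull.classes21`: `(1,4,16) ∼ (1,8,12) ∼ (2,3,16) ∼ (2,8,11) ∼ (3,6,12) ∼ (4,6,11)` and
its negative (each carries six disjoint pairs: the twelve disjoint coincidences of level `21`) -/
def big21 : List (List CoincFull.Tri) :=
  [[(1, 4, 16), (1, 8, 12), (2, 3, 16), (2, 8, 11), (3, 6, 12), (4, 6, 11)],
   [(5, 17, 20), (5, 18, 19), (9, 13, 20), (9, 15, 18), (10, 13, 19), (10, 15, 17)]]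

end HodgeFermat.KRFree.DescentB

namespace HodgeFermat.KRFree.DescentBFinal

open HodgeFermat.KRFree.LemmaN
open HodgeFermat.KRFree.CoincFull (InClass)
open HodgeFermat.KRFree.PropDPrimeN (units39)
open HodgeFermat.KRFree.DescentB (JP big15 big21)

/-- **THE DESCENT AT LEVEL 15N from (JP₁₅) — the statement.**  GIVEN `JP 15`: for every squarefree `N > 0` with all
prime factors `≥ 11` and all zero-sum triples `(a, b, c)`, `(a′, b′, c′)` mod `15N` with no entry divisible by `15N`,
DISJOINT mod `15N` and of the same CM type at level `15N` (`LemmaN.SameType (15N)`), EITHER `N = 13g` with `5g` dividing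
all six entries and both triples divided by `5g` in one class of `units39` mod `39`, OR `N` divides all six entries and
both triples divided by `N` lie in one class of `big15` mod `15`.  The universal closure of the signature of the sibling
package's `HodgeFermat.KRFree.DescentBFinal.descent15` (`DescentBFinal.lean:32`); proved in `HodgeFermatDescentBFinal.lean`
as `descent15_holds`.  (pub-hodgefermat `tables/DPRIME-THEOREM.md` §13.1; CERT.md l.993, GATE HF-G34b.) -/
def Descent15 : Prop :=
  JP 15 → ∀ ⦃N : ℕ⦄, 0 < N → Squarefree N → (∀ p ∈ N.primeFactors, 11 ≤ p) → ∀ ⦃a b c a' b' c' : ℕ⦄,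
    15 * N ∣ a + b + c → ¬ 15 * N ∣ a → ¬ 15 * N ∣ b → ¬ 15 * N ∣ c →
    15 * N ∣ a' + b' + c' → ¬ 15 * N ∣ a' → ¬ 15 * N ∣ b' → ¬ 15 * N ∣ c' →
    (∀ u v, (u = a ∨ u = b ∨ u = c) → (v = a' ∨ v = b' ∨ v = c') → ¬ u ≡ v [MOD 15 * N]) →
    SameType (15 * N) (a, b, c) (a', b', c') →
    (∃ g, N = 13 * g ∧ 5 * g ∣ a ∧ 5 * g ∣ b ∧ 5 * g ∣ c ∧ 5 * g ∣ a' ∧ 5 * g ∣ b' ∧ 5 * g ∣ c' ∧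
      ∃ cl ∈ units39, InClass cl (a / (5 * g) % 39) (b / (5 * g) % 39) (c / (5 * g) % 39) ∧
        InClass cl (a' / (5 * g) % 39) (b' / (5 * g) % 39) (c' / (5 * g) % 39)) ∨
    (N ∣ a ∧ N ∣ b ∧ N ∣ c ∧ N ∣ a' ∧ N ∣ b' ∧ N ∣ c' ∧
      ∃ cl ∈ big15, InClass cl (a / N % 15) (b / N % 15) (c / N % 15) ∧
        InClass cl (a' / N % 15) (b' / N % 15) (c' / N % 15))

/-- **THE DESCENT AT LEVEL 21N from (JP₂₁) — the statement**: as `Descent15` with `21N`, `7g` and `big21` for `15N`, `5g`,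
`big15`.  The universal closure of the signature of the sibling package's `HodgeFermat.KRFree.DescentBFinal.descent21`
(`DescentBFinal.lean:59`); proved in `HodgeFermatDescentBFinal.lean` as `descent21_holds`.  (GATE HF-G34b.) -/
def Descent21 : Prop :=
  JP 21 → ∀ ⦃N : ℕ⦄, 0 < N → Squarefree N → (∀ p ∈ N.primeFactors, 11 ≤ p) → ∀ ⦃a b c a' b' c' : ℕ⦄,
    21 * N ∣ a + b + c → ¬ 21 * N ∣ a → ¬ 21 * N ∣ b → ¬ 21 * N ∣ c →
    21 * N ∣ a' + b' + c' → ¬ 21 * N ∣ a' → ¬ 21 * N ∣ b' → ¬ 21 * N ∣ c' →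
    (∀ u v, (u = a ∨ u = b ∨ u = c) → (v = a' ∨ v = b' ∨ v = c') → ¬ u ≡ v [MOD 21 * N]) →
    SameType (21 * N) (a, b, c) (a', b', c') →
    (∃ g, N = 13 * g ∧ 7 * g ∣ a ∧ 7 * g ∣ b ∧ 7 * g ∣ c ∧ 7 * g ∣ a' ∧ 7 * g ∣ b' ∧ 7 * g ∣ c' ∧
      ∃ cl ∈ units39, InClass cl (a / (7 * g) % 39) (b / (7 * g) % 39) (c / (7 * g) % 39) ∧
        InClass cl (a' / (7 * g) % 39) (b' / (7 * g) % 39) (c' / (7 * g) % 39)) ∨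
    (N ∣ a ∧ N ∣ b ∧ N ∣ c ∧ N ∣ a' ∧ N ∣ b' ∧ N ∣ c' ∧
      ∃ cl ∈ big21, InClass cl (a / N % 21) (b / N % 21) (c / N % 21) ∧
        InClass cl (a' / N % 21) (b' / N % 21) (c' / N % 21))

end HodgeFermat.KRFree.DescentBFinal
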